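import Summits.BirchSwinnertonDyer.Rank1Residual.ManinAdditive.ThetaBrandtDegreeLaws
import HarnessLib
import HarnessLib.Audit.Tags

/-!
# The Tamagawa numbers at the ODD MULTIPLICATIVE primes `q ∥ N/4` read off the mod-3 Hecke system at the LOWER level:
# rows E-desc-120 / 120♭ (mod 3) and E-desc-121 / 121♭ (mod 9) typed (cell `bsd-f2-manin`, desc g17 ADDENDUM 2, MEMO-desc §37; nothing asserted)

SKETCH (planner bsd-f2-manin-desc g17).  Sibling of `ThetaBrandtDegreeLaws.lean` / `ThetaBrandtTamagawaTwo.lean`.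
Engine + census: `HOME/desc/g17c/` (`oldq.py`, `oldq_lean.py`, `OLDQ-census-g17c.md`, `SHA16SUMS.desc.g17c`).

THE OBJECT.  For an odd prime `p` the FULL quaternionic space of level `p` at "level `1 + 2O₂` at the ramified prime" is
`Fun(ℙ¹(𝔽_p), ℤ)` — functions on the `p + 1` points WITHOUT the Hurwitz-unit quotient: `B^×\B̂^×/(1+2O₂)·∏_{v odd} R_v^× ≅
O^×\(O₂^×/(1+2O₂) × ℙ¹(𝔽_p)) ≅ ℙ¹(𝔽_p)` because `O^×/±1 ≅ O₂^×/(1+2O₂) ≅ A₄`.  It contains every `D^×`-isotypic type at `2`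
trivial on `1 + 2O₂`: the trivial type (newforms of level `2p`, multiplicative at `2`), `θ, θ̄` (level `4p`, our `𝓜_θ`) and the
3-dimensional type (level `8p`).  Its Hecke operator at an odd prime `ℓ ≠ p` is
  `(T_ℓ f)(x) = Σ_{γ ∈ O^×\{Nrd γ = ℓ}} f(u_γ⁻¹ γ x)`,  `u_γ ∈ O^×` the unit with `u_γ ≡ ±γ (mod 2O₂)`
(in doubled coordinates: all four coordinates of `γ − u` are `≡ 0 (mod 4)`, or all are `≡ 2 (mod 4)`); summing over ALL `γ` of norm `ℓ`
and both solutions `±u` gives `48 · T_ℓ` (`fullHecke48`), an honest `ℤ`-valued finite sum over tree data (`hurwitzOfNorm`, `hurwitzUnits`,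
`act`).  A mod-3 Hecke eigensystem `(a_ℓ mod 3)_ℓ` OCCURS at level `p` iff `∃ v : ℙ¹(𝔽_p) → ℤ`, `v ≢ 0 (mod 3)`, with
`T_ℓ v ≡ a_ℓ v (mod 3)` for all `ℓ ∤ 6pq`, i.e. `144 ∣ 48·T_ℓ v − 48·a_ℓ·v` (`IsOldModThreeAtPrimeLevel`).

LAW E-desc-120 (`UnramifiedAtQIffOldModThreeAtFourQP`).  ANY elliptic curve `E/ℚ` of conductor `N = 4·q·p` (`p ≥ 5`,
`q` odd primes, `q ≠ p`; so `q ∥ N` is a MULTIPLICATIVE prime and `4 ∥ N`), with `ρ̄_{E,3}` irreducible (typed E-facingly but checkably as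
`¬ IsReducibleModThreeBySymbol`: no quadratic `ψ = (D/·)`, `D ∣ 4N`, with `a_ℓ ≡ ψ(ℓ)(ℓ+1) (mod 3)` — Brauer–Nesbitt):
    `3 ∣ v_q(Δ_min(E))   ⟺   the mod-3 system (a_ℓ(E) mod 3)_{ℓ ∤ 6pq} occurs in Fun(ℙ¹(𝔽_p))`,
and its TAMAGAWA COROLLARY E-desc-120♭ (`TamagawaAtOddFromLowerLevelAtFourQP`): `3 ∣ c_q(E) ⟺ (that) ∧ a_q(E) = +1`.
WHY (THEOREM-CANDIDATE R′ on paper): `3 ∣ v_q(Δ)` ⟺ `ρ̄_{E,3}` unramified (finite if `q = 3`) at `q` (Tate curve) ⟺ [Ribet 1990 level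
lowering at `q ∥ N`, `ℓ = 3`; Mazur for `q = 3`] `ρ̄` is modular of level `4p`, necessarily from a newform of level `2p` or `4p` (its conductor
at `2` is `2`: `ρ̄(I₂)` is unipotent of order `3`), whose Jacquet–Langlands transfer to `B_{2,∞}` lies in `Fun(ℙ¹(𝔽_p))` (trivial resp. `θ`
type) and reduces to a mod-3 eigenvector; conversely a mod-3 eigenvector lifts (Deligne–Serre) to a `D^×`-eigenform of level prime to `q`
carrying `ρ̄` (irreducible ⇒ determined by traces), so `ρ̄` is unramified at `q`.  And `c_q = v_q(Δ)` in the split case, `∈ {1, 2}` in the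
non-split case (Tate's algorithm).  For `ρ̄₃` REDUCIBLE the system-level test is blind (Eisenstein systems occur at every level): no law.
CENSUS (`HOME/desc/g17c/OLDQ-rows.tsv`, all optimal `E` with `4 ∥ N ≤ 5780` and every `q ∥ N/4`, composite `N/4q` included — the law is
stated here at `N/4q` prime only because the tree's point model `Fin (p+1)` is prime-level): see MEMO-desc §37 (0 exceptions on the
`ρ̄₃`-irreducible rows).  Kernel certificate below: `228a1` (`N = 4·3·19`, `v₃(Δ) = 3`, non-split: `ρ̄₃` unramified at `3` although `c₃ = 1`)
— an explicit `v : Fin 20 → ℤ` with `T₅ v ≡ 2v`, `T₇ v ≡ 0·v (mod 3)` (`a₅(228a1) = 2`, `a₇(228a1) = 0`).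

TYPER NOTE (typer g18, T-desc-29).  SOURCE = HOME/desc/g17c/ThetaBrandtTamagawaOdd.lean sha16 3e890f36d0660d10 (154 l.; farm rc 0 · 0 err · 0 warn ·
0 sorry, 193.9 s, check-odd.json; BC7 ProbeG17d.txt 4/4 CLEAN), landed VERBATIM as a sibling of `ThetaBrandtDegreeLaws.lean` (imported) /
`ThetaBrandtTamagawaTwo.lean` (p701245) except: (i) this note and the cite block; (ii) one-line docstrings on `v228a_old_five_seven`, `v492b_old_mod_nine_five`,
`v492b_old_mod_nine_seven` (gate docstring lint); nothing else changed.  DECLS: computable `DQuat.dconj`, `isCongModTwoO` (`Bool`, no instances), `fullHecke48` (`48·T_ℓ` on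
`Fun(ℙ¹(𝔽_p), ℤ)` WITH the unit correction `u_γ`), `IsOldModThreeAtPrimeLevel`, `IsReducibleModThreeBySymbol`, `IsOldModNineAtPrimeLevel`
(plain `def … : Prop` predicates with bodies); obligation nodes (`@[conjecture]`, NOTHING asserted) **E-desc-120 `UnramifiedAtQIffOldModThreeAtFourQP`**,
**E-desc-120♭ `TamagawaAtOddFromLowerLevelAtFourQP`**, **E-desc-121 `NineDvdDiscValuationIffOldModNineAtFourQP`**, **E-desc-121♭
`TamagawaNineFromLowerLevelAtFourQP`**; kernel certificates (`decide +kernel`) `v228a` / `v228a_old_five_seven` (228a1: the mod-3 system occurs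
at quaternionic level 19) and `v492b` / `v492b_old_mod_nine_five` / `v492b_old_mod_nine_seven` (492b1: occurs MOD 9 at level 41;
`maxHeartbeats 4000000` each, per desc).
HONEST FRAMING.  LENS: desc (component groups; the definite-quaternion side of Jacquet–Langlands at the ramified prime 2).  IN PRINT / NOT:
E-desc-120 is a THEOREM-CANDIDATE on paper (dictionary R′, MEMO-desc §37.3: `3 ∣ v_q(Δ)` ⟺ `ρ̄_{E,3}` unramified at the MULTIPLICATIVE
prime `q` (Tate curve; finite-flat at `q = 3`) ⟺ [Ribet 1990 level lowering at `q ∥ N`, `ℓ = 3`; Mazur at `q = 3`] modular of level `4p`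
⟹ Jacquet–Langlands to `B_{2,∞}` inside `Fun(ℙ¹(𝔽_p))` ⟹ a mod-3 eigenvector; conversely Deligne–Serre lifting) — the ingredients are
print, the quaternionic mod-3 OCCURRENCE formulation with the unit-corrected operator and its Tamagawa corollary 120♭ are the cell's;
E-desc-121 (mod 9) is «level lowering modulo 9», OPEN in print (weak eigenforms mod prime powers: Tsaknias–Wiese; only partial results) —
a genuine LAW.  The `ρ̄₃`-reducible case carries no law (Eisenstein systems occur at every level).  NEAREST PRINT BY NAME: [Ribet1990]
(level lowering, multiplicative prime), [DeligneSerre1974] (lifting lemma), [JacquetLanglands1970] / [Pizer1980] (definite quaternion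
algebra side), [TsakniasWiese2017] (eigenforms modulo prime powers), [Tate1975] / [SilvermanATAEC1994] (c_q = v_q(Δ) split, ∈ {1,2}
non-split).  desc presearch: HOME/desc/g17c/presearch-g17c.txt (corpus + galaxy, labelled).  WHY NOVEL (desc): the Tamagawa numbers at the
odd multiplicative primes of a `4 ∥ N` curve are read off ONE finite ℤ-module `Fun(ℙ¹(ℤ/M'))` of `B_{2,∞}` by mod-3 / mod-9 occurrence,
exactly (`ord₃ c_q = [a_q = +1]·max{j ≤ 2 : occurs mod 3^j}`) on the whole census.
BC5 WITNESS: HOME/desc/g17c/OLDQ-census-g17c.md sha16 64042bdbd7b53cc9, table OLDQ-all.tsv 58e3c20ce1616560 (two implementations `oldq.py` /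
`oldq_lean.py`): 3071 pairs (E, q) = 1634 optimal curves with `4 ∥ N ≤ 5780` and an odd multiplicative prime; `ρ̄₃`-irreducible rows 2535:
E-120 old ∧ 3∣v 235 + new ∧ 3∤v 2300 = 2535/2535, E-120♭ 2535/2535, E-121 235/235 (9∣v ∧ mod 9: 23), E-121♭ exact on all 2535 (27 ∣ v_q(Δ):
0 in range); typed prime-cofactor range `N = 4qp`: 733 rows (old 90, 9 ∣ v 16), 0 exceptions; `U_q` on the θ-line = `a_q` 2909/2909 —
meets 2535 / beyond-print 2535 / violations 0.  CHEAPEST FALSIFIER (desc, run): one irreducible pair with (3 ∣ v_q(Δ)) ≠ (old mod 3) —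
0/2535; next: D-desc-26 (modular-symbols second engine mod 3 / mod 9 at Γ₀(N/q); extend to N ≤ 20 000).  REFUTER VERDICTS: R-desc-29 (ref1:
(a) the `u_γ`-corrected operator vs Pizer 1980 at p = 2, (b) R′, (c) grade E-121 vs Dummigan / Camporino–Pacetti / Dahmen–Yazdani)
PENDING at filing — a row killed AS TYPED is repaired under a NEW name (append-only) and this text then gets a SUPERSEDED paragraph; ref2
placement PENDING.  The owner (desc g17) asked for this landing explicitly (T-desc-29).  PARTITION currency: rows about `c_q` at the odd
multiplicative primes of optimal curves with `4 ∥ N` (MS-ii side); beyond-print theorem: NO; bears_on: stmt-BirchSwinnertonDyer-22967 (C2)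
via the local data of `4 ∥ N` optimal curves.  BSD is not proved by this; Manin's conjecture is not proved by this; C2/C3 OPEN.
[cite: Ribet1990, (level lowering at a prime q ∥ N, ℓ = 3 ∤ N: dictionary R′ step; locator per desc — source not held by the cell, acq-09883; shape only — the quaternionic mod-3 occurrence law is the cell's E-desc-120, MEMO-desc §37, NOT in print as stated)]
[cite: DeligneSerre1974, Lemme 6.11 (lifting a mod-ℓ Hecke eigensystem to characteristic 0; dictionary R′ converse step; shape only)]
[cite: JacquetLanglands1970, §16 (correspondence with the definite quaternion algebra; shape only)] [cite: Pizer1980, Thm. 3.13 (Brandt matrices of non-Eichler level at 2; shape only)]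
[cite: TsakniasWiese2017, §2 (weak / strong eigenforms modulo prime powers — the setting of E-desc-121; level lowering mod 9 is NOT in print)]
[cite: Tate1975, §§7–8 (c_q = v_q(Δ) for split multiplicative reduction, ∈ {1,2} non-split)] [cite: CremonaEcdata, (optimal curves, c_q, a_q: census inputs)]
-/

open scoped MatrixGroups ModularForm
open CongruenceSubgroup WeierstrassCurve Literature.NumberTheory.EllipticCurves.ModularForms
open Summit.BirchSwinnertonDyer.Rank1Residual.ManinAdditive.ConwayCut
open Summit.BirchSwinnertonDyer.Rank1Residual.ManinAdditive.RamanujanCut (HasRationalThreeTorsion)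
open Summit.BirchSwinnertonDyer.Rank1Residual.ManinAdditive.JumpDegree
open Summit.BirchSwinnertonDyer.Rank1Residual.ManinAdditive.HurwitzBrandt

namespace Summit.BirchSwinnertonDyer.Rank1Residual.ManinAdditive.ThetaBrandt

/-! ## §5.1 The full-level Hecke operator on `Fun(ℙ¹(𝔽_p), ℤ)` -/

/-- quaternion conjugate in doubled coordinates -/
def DQuat.dconj (q : DQuat) : DQuat := (q.1, -q.2.1, -q.2.2.1, -q.2.2.2)

/-- `γ ≡ u (mod 2O₂)` up to sign, for `γ` of odd norm and a Hurwitz unit `u` (doubled coordinates: `2O` = all four coordinates `≡ 0 (mod 4)`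
or all four `≡ 2 (mod 4)`); `Bool`-valued so that it can be filtered on without declaring instances. -/
def isCongModTwoO (γ u : DQuat) : Bool :=
  (((γ.1 - u.1) % 4 == 0) && ((γ.2.1 - u.2.1) % 4 == 0) && ((γ.2.2.1 - u.2.2.1) % 4 == 0) && ((γ.2.2.2 - u.2.2.2) % 4 == 0)) ||
  (((γ.1 - u.1) % 4 == 2) && ((γ.2.1 - u.2.1) % 4 == 2) && ((γ.2.2.1 - u.2.2.1) % 4 == 2) && ((γ.2.2.2 - u.2.2.2) % 4 == 2))

/-- `48 · T_ℓ` on `Fun(ℙ¹(𝔽_p), ℤ)`: `Σ_{Nrd γ = ℓ} Σ_{u ∈ O^×, u ≡ ±γ (2O₂)} f(ū γ x)` (each unit coset counted `24×`, each `γ` with its two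
units `±u_γ`). -/
def fullHecke48 (p ℓ : ℕ) (f : Fin (p + 1) → ℤ) (x : Fin (p + 1)) : ℤ :=
  ((hurwitzOfNorm ℓ).map fun γ =>
    ((hurwitzUnits.filter fun u => isCongModTwoO γ u).map fun u => f (act p (DQuat.dconj u) (act p γ x))).sum).sum

/-- the mod-3 Hecke system `a` (values at primes `ℓ ∤ S`) OCCURS in `Fun(ℙ¹(𝔽_p)) ⊗ 𝔽₃`: a common eigenvector mod 3. -/
def IsOldModThreeAtPrimeLevel (p S : ℕ) (a : ℕ → ℤ) : Prop :=
  ∃ v : Fin (p + 1) → ℤ, (∃ x, ¬ (3 : ℤ) ∣ v x) ∧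
    ∀ ℓ : ℕ, ℓ.Prime → ¬ ℓ ∣ S → ∀ x : Fin (p + 1), (144 : ℤ) ∣ fullHecke48 p ℓ v x - 48 * a ℓ * v x

/-- `ρ̄_{E,3}` is REDUCIBLE, typed by its trace criterion (Brauer–Nesbitt + Chebotarev): `a_ℓ(E) ≡ ψ(ℓ)(ℓ + 1) (mod 3)` at all good
`ℓ ∤ 6N` for some quadratic `ψ = (D/·)` with `D ∣ 4N` (characters ramified at `3` are absorbed by `χ̄₃`). -/
def IsReducibleModThreeBySymbol (W : WeierstrassCurve ℚ) : Prop :=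
  ∃ D : ℤ, D ≠ 0 ∧ D ∣ 4 * W.conductorNorm ℤ ∧
    ∀ ℓ : ℕ, ℓ.Prime → ¬ (ℓ : ℤ) ∣ 6 * W.conductorNorm ℤ → (3 : ℤ) ∣ W.LFunction ℓ - jacobiSym D ℓ * (ℓ + 1)

/-! ## §5.2 The laws -/

/-- **Row E-desc-120 `UnramifiedAtQIffOldModThreeAtFourQP` (LAW; THEOREM-CANDIDATE R′ on paper via Ribet 1990 + Jacquet–Langlands +
Deligne–Serre; MEMO-desc §37).**  `N = 4qp`, `ρ̄₃` irreducible: `3 ∣ v_q(Δ_min) ⟺` the mod-3 system of `E` occurs at quaternionic level `p`.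
WHY IT MIGHT FAIL: only through a mis-typing of `fullHecke48` (the unit correction `u_γ`) — the statement itself is level lowering;
`q = 3` relies on the finite-flat case.  Census: 0 exceptions on all irreducible `(E, q)` with `4 ∥ N ≤ 5780` (composite cofactor included). -/
@[conjecture]
def UnramifiedAtQIffOldModThreeAtFourQP : Prop :=
  ∀ (p q : ℕ), p.Prime → q.Prime → 5 ≤ p → q ≠ 2 → q ≠ p →
  ∀ (W : WeierstrassCurve ℚ) [W.IsElliptic] [W.IsGloballyMinimal],
    W.conductorNorm ℤ = 4 * q * p → ¬ IsReducibleModThreeBySymbol W →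
    ((3 : ℤ) ∣ padicValRat q W.Δ ↔ IsOldModThreeAtPrimeLevel p (6 * p * q) fun n => W.LFunction n)

/-- **Row E-desc-120♭ `TamagawaAtOddFromLowerLevelAtFourQP` (LAW: the Tamagawa number at the multiplicative prime `q`).**
`3 ∣ c_q(E) ⟺` (mod-3 system occurs at level `p`) `∧ a_q(E) = +1` (split).  (`ord₃ c_q` itself is `ord₃ v_q(Δ)` in the split case —
positivity is what the mod-3 level sees; `9 ∣ v_q(Δ)` would need the mod-9 system, MEMO §37.4.) -/
@[conjecture]
def TamagawaAtOddFromLowerLevelAtFourQP : Prop :=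
  ∀ (p q : ℕ), p.Prime → q.Prime → 5 ≤ p → q ≠ 2 → q ≠ p →
  ∀ (W : WeierstrassCurve ℚ) [W.IsElliptic] [W.IsGloballyMinimal],
    W.conductorNorm ℤ = 4 * q * p → ¬ IsReducibleModThreeBySymbol W →
    (3 ∣ tamagawaAt W q ↔ (IsOldModThreeAtPrimeLevel p (6 * p * q) (fun n => W.LFunction n) ∧ W.LFunction q = 1))

/-! ## §5.3 Kernel certificate: `228a1` (`N = 4·3·19`; `a₅ = 2`, `a₇ = 0`; `v₃(Δ) = 3`, non-split, `c₃ = 1`) -/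

/-- a mod-3 eigenvector at quaternionic level `19` for the system of `228a1` (from `oldq_lean.py`; the old space has dimension `2`). -/
def v228a : Fin 20 → ℤ := ![0, 1, 1, 0, -1, 0, 0, 0, 0, 1, 0, -1, -1, 0, -1, 0, 0, 0, 1, 0]

/-- `228a1`: the mod-3 system (`a₅ = 2`, `a₇ = 0`) occurs at quaternionic level `19` (kernel certificate; typer-added docstring). -/
theorem v228a_old_five_seven :
    (∀ x : Fin 20, (144 : ℤ) ∣ fullHecke48 19 5 v228a x - 48 * 2 * v228a x) ∧
    (∀ x : Fin 20, (144 : ℤ) ∣ fullHecke48 19 7 v228a x - 48 * 0 * v228a x) := by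
  refine ⟨?_, ?_⟩ <;> decide +kernel

/-! ## §5.4 The mod-9 refinement (row E-desc-121): `9 ∣ v_q(Δ)` is read by the same module one power of `λ²… = 3` higher -/

/-- the Hecke system `a` (integers now matter mod 9) OCCURS MOD 9 in `Fun(ℙ¹(𝔽_p))`: `∃ v ≢ 0 (mod 3)` with `T_ℓ v ≡ a_ℓ v (mod 9)`, i.e.
`432 = 48·9 ∣ 48·T_ℓ v − 48·a_ℓ·v`, for all primes `ℓ ∤ S`. -/
def IsOldModNineAtPrimeLevel (p S : ℕ) (a : ℕ → ℤ) : Prop :=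
  ∃ v : Fin (p + 1) → ℤ, (∃ x, ¬ (3 : ℤ) ∣ v x) ∧
    ∀ ℓ : ℕ, ℓ.Prime → ¬ ℓ ∣ S → ∀ x : Fin (p + 1), (432 : ℤ) ∣ fullHecke48 p ℓ v x - 48 * a ℓ * v x

/-- **Row E-desc-121 `NineDvdDiscValuationIffOldModNineAtFourQP` (LAW = «level lowering modulo 9» in quaternionic currency; MEMO-desc §37.4).**
`N = 4qp`, `ρ̄₃` irreducible: `9 ∣ v_q(Δ_min) ⟺` the system `(a_ℓ(E))_ℓ` occurs MOD 9 at quaternionic level `p`.  WHY IT MIGHT FAIL: level lowering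
modulo prime POWERS is only known under extra hypotheses (Dummigan; Tsaknias–Wiese) — the direction «occurs mod 9 ⇒ `ρ_{E,3} mod 9` unramified at
`q`» needs a mod-9 multiplicity-one / Ihara-type statement at the prime `q`; the census is the evidence.  Census: MEMO-desc §37.4 (0 exceptions). -/
@[conjecture]
def NineDvdDiscValuationIffOldModNineAtFourQP : Prop :=
  ∀ (p q : ℕ), p.Prime → q.Prime → 5 ≤ p → q ≠ 2 → q ≠ p →
  ∀ (W : WeierstrassCurve ℚ) [W.IsElliptic] [W.IsGloballyMinimal],
    W.conductorNorm ℤ = 4 * q * p → ¬ IsReducibleModThreeBySymbol W →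
    ((9 : ℤ) ∣ padicValRat q W.Δ ↔ IsOldModNineAtPrimeLevel p (6 * p * q) fun n => W.LFunction n)

/-- **Row E-desc-121♭ `TamagawaNineFromLowerLevelAtFourQP`.**  `9 ∣ c_q(E) ⟺` (system occurs mod 9 at level `p`) `∧ a_q(E) = +1`; with
E-desc-120♭: `ord₃ c_q(E) = max {j ≤ 2 : the system occurs mod 3^j}` in the split case (`27 ∣ c_q` does not occur for `4 ∥ N ≤ 5780`). -/
@[conjecture]
def TamagawaNineFromLowerLevelAtFourQP : Prop :=
  ∀ (p q : ℕ), p.Prime → q.Prime → 5 ≤ p → q ≠ 2 → q ≠ p →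
  ∀ (W : WeierstrassCurve ℚ) [W.IsElliptic] [W.IsGloballyMinimal],
    W.conductorNorm ℤ = 4 * q * p → ¬ IsReducibleModThreeBySymbol W →
    (9 ∣ tamagawaAt W q ↔ (IsOldModNineAtPrimeLevel p (6 * p * q) (fun n => W.LFunction n) ∧ W.LFunction q = 1))

/-! ## §5.5 Kernel certificate mod 9: `492b1` (`N = 4·3·41`; `a₅ = −2`, `a₇ = −4`; `v₃(Δ) = 9`, split, `c₃ = 9`) -/

/-- a mod-9 eigenvector at quaternionic level `41` for the system of `492b1` (from `oldq9_lean.py`, solved simultaneously at `ℓ = 5, 7, 11, 13`). -/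
def v492b : Fin 42 → ℤ :=
  ![0, 3, -3, 0, 1, -1, 2, 2, -1, -3, 1, 1, -1, -2, 0, 1, 3, -1, 3, -2, -3, -3, -2, 3, -1, 3, 1, 0, -2, -1, 1, 1, -3, -1, 2, 2, -1, 1, 0, -3, 3, 0]

set_option maxHeartbeats 4000000 in
/-- `492b1`: the system occurs MOD 9 at quaternionic level `41`, checked at `ℓ = 5` (`a₅ = −2`; kernel certificate; typer-added docstring). -/
theorem v492b_old_mod_nine_five :
    ∀ x : Fin 42, (432 : ℤ) ∣ fullHecke48 41 5 v492b x - 48 * (-2) * v492b x := by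
  decide +kernel

set_option maxHeartbeats 4000000 in
/-- `492b1`: the system occurs MOD 9 at quaternionic level `41`, checked at `ℓ = 7` (`a₇ = −4`; kernel certificate; typer-added docstring). -/
theorem v492b_old_mod_nine_seven :
    ∀ x : Fin 42, (432 : ℤ) ∣ fullHecke48 41 7 v492b x - 48 * (-4) * v492b x := by
  decide +kernel

end Summit.BirchSwinnertonDyer.Rank1Residual.ManinAdditive.ThetaBrandt
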